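import Mathlib
import Literature.Computability.AlgebraicComplexity.GroupTheoreticMatMul
import Literature.Computability.AlgebraicComplexity.GroupTheoreticMatMulThmBProofs
import Summits.MatrixMultiplication.MatrixMultiplication.Theses.ThinBlockAlpha
import Summits.MatrixMultiplication.MatrixMultiplication.Theorems.ThinBlockAlphaThinPackingsOrbitCriterion

/-!
# Orbit designs are the crux in costume: `ThinPackings →` orbit designs (symmetrisation)

Line `automorphism-orbit-twisted-templates` (skeleton `Lines/Ideator4Sketch.lean`) of crux
`ThinBlockAlpha.ThinPackings` (stmt-MatrixMultiplication-10595), lead c4, 2026-08-16.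

The line's heart `stub_orbitDesigns` (the card's `OrbitThinPackings`) asks for thin near-tight
ORBIT designs: one template `(A, B, C)` in a finite abelian `H`, TPP and `Γ`-twisted sum-free
under a finite group `Γ` of additive automorphisms, of shape `⟨N, M, N⟩`, `2 ≤ N`, `N^a ≤ M`,
`|H| ≤ |Γ|·N^{2+η}`, for every `a < 1`, `η > 0`.  The landed transfer
(`Orbit.thinPackings_of_orbitDesigns`, p122325) gives heart `→` crux.  THIS FILE proves the
converse, so the heart is EQUIVALENT to the crux (`orbitDesigns_iff_thinPackings`): the orbit
restriction is void asymptotically and the line is a reformulation of the crux, not a reduction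
(and hence, by `Negative/ThinPackingsIffCThesis`, p76748, equivalent to `X_C` = stmt-0593).

SYMMETRISATION.  For an STPP family `(A_i, B_i, C_i)_{i ∈ ι}` in `H`, the template
`(∏_i A_i, ∏_i B_i, ∏_i C_i)` in `H^ι` is TPP and twisted sum-free under the group
`(Perm ι)ᵈᵐᵃ` permuting coordinates (`templateTPP_piFinset`, `twistedSumFree_piFinset`): a
twisted relation read in coordinate `l` is an STPP relation of the original family with labels
`(σ l, τ l, l)`, so `σ l = τ l = l` for every `l`.  (Equivalently: the orbit family is the
permutation sub-family of the `ι`-th tensor power.)  Bookkeeping: `N ↦ N^{|ι|}`, `M ↦ M^{|ι|}`,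
`|H| ↦ |H|^{|ι|}`, `|Γ| = |ι|!`, so the slack grows by `|ι|^{|ι|}/|ι|! ≤ e^{|ι|}`
(`pow_self_le_factorial_mul_exp`), which is absorbed by `N^{|ι|·η/2}` as soon as
`N^{η/2} ≥ e`; that is arranged by first passing to the `k`-th tensor power of the crux witness
(`AddSimultaneousTPP.pi`, `N ↦ N^k`).
-/

set_option linter.dupNamespace false  -- `Summit.<S>.<S>.…` is the mandated namespace

namespace Summit.MatrixMultiplication.MatrixMultiplication.Theorems.ThinPackings.Orbit

open Finset Literature.Computability.AlgebraicComplexity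
open Literature.Combinatorics.Additive (AddSimultaneousTPP addSimultaneousTPP_iff_forall)
open Summit.MatrixMultiplication.MatrixMultiplication.Theses.ThinBlockAlpha (ThinPackings)

section Symmetrise

variable {ι H : Type} [Fintype ι] [DecidableEq ι] [AddCommGroup H] {A B C : ι → Finset H}

/-- The box template `(∏ A_i, ∏ B_i, ∏ C_i)` of an STPP family is TPP (coordinatewise, the
diagonal clause `i = j = k` of the family). [new, elementary] -/
theorem templateTPP_piFinset (h : AddSimultaneousTPP A B C) :
    TemplateTPP (Fintype.piFinset A) (Fintype.piFinset B) (Fintype.piFinset C) := by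
  rw [addSimultaneousTPP_iff_forall] at h
  intro a ha a' ha' b hb b' hb' c hc c' hc' h0
  simp only [Fintype.mem_piFinset] at ha ha' hb hb' hc hc'
  have hl : ∀ l, a l = a' l ∧ b l = b' l ∧ c l = c' l := fun l => by
    have h0l := congr_fun h0 l
    simp only [Pi.add_apply, Pi.sub_apply, Pi.zero_apply] at h0l
    obtain ⟨-, -, h1, h2, h3⟩ :=
      h l l l _ (ha l) _ (ha' l) _ (hb l) _ (hb' l) _ (hc l) _ (hc' l) h0l
    exact ⟨h1, h2, h3⟩
  exact ⟨funext fun l => (hl l).1, funext fun l => (hl l).2.1, funext fun l => (hl l).2.2⟩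

/-- The box template of an STPP family is twisted sum-free under the coordinate permutations
`(Perm ι)ᵈᵐᵃ` (acting by `(g • x) l = x (σ l)`, `σ = mk.symm g`): a twisted relation read in
coordinate `l` is an STPP relation of the family with labels `(σ l, τ l, l)`, whence
`σ l = τ l = l`. [new, elementary] -/
theorem twistedSumFree_piFinset (h : AddSimultaneousTPP A B C) :
    TwistedSumFree (Equiv.Perm ι)ᵈᵐᵃ
      (Fintype.piFinset A) (Fintype.piFinset B) (Fintype.piFinset C) := by
  rw [addSimultaneousTPP_iff_forall] at h
  intro g k hgk a' ha' b hb b' hb' c hc c' hc' a ha h0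
  simp only [Fintype.mem_piFinset] at ha ha' hb hb' hc hc'
  apply hgk
  set σ := DomMulAct.mk.symm g with hσ
  set τ := DomMulAct.mk.symm k with hτ
  have hl : ∀ l, σ l = l ∧ τ l = l := fun l => by
    have h0l := congr_fun h0 l
    simp only [Pi.add_apply, Pi.sub_apply, Pi.zero_apply, DomMulAct.smul_apply,
      Equiv.Perm.smul_def] at h0l
    rw [← hσ, ← hτ] at h0l
    obtain ⟨h1, h2, -⟩ := h (σ l) (τ l) l (a l) (ha l) (a' (σ l)) (ha' _) (b (σ l)) (hb _)
      (b' (τ l)) (hb' _) (c (τ l)) (hc _) (c' l) (hc' l) (by rw [← h0l]; abel)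
    exact ⟨h1.trans h2, h2⟩
  have hσ1 : σ = 1 := Equiv.ext fun l => by rw [Equiv.Perm.one_apply]; exact (hl l).1
  have hτ1 : τ = 1 := Equiv.ext fun l => by rw [Equiv.Perm.one_apply]; exact (hl l).2
  have hg : g = 1 := by
    rw [← DomMulAct.mk.apply_symm_apply g, ← hσ, hσ1]; rfl
  have hk : k = 1 := by
    rw [← DomMulAct.mk.apply_symm_apply k, ← hτ, hτ1]; rfl
  rw [hg, hk]

end Symmetrise

/-- Cardinality of a box all of whose sides have `N` elements. -/
theorem card_piFinset_of_card_eq {ι α : Type} [Fintype ι] [DecidableEq ι] {A : ι → Finset α}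
    {N : ℕ} (hA : ∀ i, (A i).card = N) :
    (Fintype.piFinset A).card = N ^ Fintype.card ι := by
  rw [Fintype.card_piFinset, Finset.prod_congr rfl fun i _ => hA i, Finset.prod_const,
    Finset.card_univ]

/-- `n^n ≤ n!·e^n` (the term `n^n/n!` of the exponential series). -/
theorem pow_self_le_factorial_mul_exp (n : ℕ) :
    (n : ℝ) ^ n ≤ (n.factorial : ℝ) * Real.exp 1 ^ n := by
  have h := Real.pow_div_factorial_le_exp (n : ℝ) (Nat.cast_nonneg n) n
  rw [div_le_iff₀ (by positivity)] at h
  calc (n : ℝ) ^ n ≤ Real.exp n * n.factorial := h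
    _ = n.factorial * Real.exp 1 ^ n := by rw [← Real.exp_nat_mul, mul_one, mul_comm]

/-- The slack bookkeeping of the symmetrised power: if `|H| ≤ L·N^{2+η/2}` and `e ≤ (N^{η/2})^k`
then `|H|^{k·n} ≤ n!·(N^{k n})^{2+η}` for `n = L^k`. -/
theorem symmetrised_slack {L k n N : ℕ} {η Hc : ℝ} (hn : n = L ^ k) (hHc : 0 ≤ Hc)
    (hN : 0 < (N : ℝ)) (hH : Hc ≤ L * (N : ℝ) ^ (2 + η / 2))
    (he : Real.exp 1 ≤ ((N : ℝ) ^ (η / 2)) ^ k) :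
    Hc ^ (k * n) ≤ (n.factorial : ℝ) * ((N : ℝ) ^ (k * n)) ^ (2 + η) := by
  -- abbreviations
  set P : ℝ := (N : ℝ) ^ (2 + η / 2) with hP
  set x : ℝ := ((N : ℝ) ^ (η / 2)) ^ k with hx
  have hP0 : 0 < P := Real.rpow_pos_of_pos hN _
  have hx0 : 0 ≤ x := pow_nonneg (Real.rpow_nonneg hN.le _) _
  -- the right-hand side, rewritten: `(N^{kn})^{2+η} = P^{kn} · x^n`
  have hR : ((N : ℝ) ^ (k * n)) ^ (2 + η) = P ^ (k * n) * x ^ n := by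
    have h1 : ((N : ℝ) ^ (k * n)) ^ (2 + η) = ((N : ℝ) ^ (2 + η)) ^ (k * n) := by
      rw [← Real.rpow_natCast_mul hN.le, mul_comm ((k * n : ℕ) : ℝ) (2 + η),
        Real.rpow_mul_natCast hN.le]
    have h2 : (N : ℝ) ^ (2 + η) = P * (N : ℝ) ^ (η / 2) := by
      rw [hP, ← Real.rpow_add hN]; congr 1; ring
    rw [h1, h2, mul_pow, pow_mul ((N : ℝ) ^ (η / 2)) k n]
  -- the left-hand side: `Hc^{kn} ≤ (L P)^{kn} = n^n · P^{kn}`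
  have hL : Hc ^ (k * n) ≤ (n : ℝ) ^ n * P ^ (k * n) := by
    calc Hc ^ (k * n) ≤ ((L : ℝ) * P) ^ (k * n) := pow_le_pow_left₀ hHc hH _
      _ = (n : ℝ) ^ n * P ^ (k * n) := by
          rw [mul_pow, pow_mul, hn]; push_cast; ring
  -- `n^n ≤ n! e^n ≤ n! x^n`
  have hmid : (n : ℝ) ^ n ≤ (n.factorial : ℝ) * x ^ n :=
    (pow_self_le_factorial_mul_exp n).trans
      (mul_le_mul_of_nonneg_left (pow_le_pow_left₀ (Real.exp_pos 1).le he n)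
        (Nat.cast_nonneg _))
  calc Hc ^ (k * n) ≤ (n : ℝ) ^ n * P ^ (k * n) := hL
    _ ≤ (n.factorial : ℝ) * x ^ n * P ^ (k * n) :=
        mul_le_mul_of_nonneg_right hmid (pow_nonneg hP0.le _)
    _ = (n.factorial : ℝ) * ((N : ℝ) ^ (k * n)) ^ (2 + η) := by rw [hR]; ring

/-- **The crux gives orbit designs** (converse of the transfer `thinPackings_of_orbitDesigns`):
every thin near-tight STPP family symmetrises into a thin near-tight orbit design — the box
template of its `k`-th tensor power under the coordinate permutations of `H^{(Fin k → Fin L)}`.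
Hence the line's heart `stub_orbitDesigns` is the crux in costume. [new, elementary] -/
theorem orbitDesigns_of_thinPackings (hT : ThinPackings) :
    ∀ a : ℝ, 0 ≤ a → a < 1 → ∀ η : ℝ, 0 < η →
      ∃ (Γ H : Type) (_ : Group Γ) (_ : Fintype Γ) (_ : AddCommGroup H) (_ : Fintype H)
        (_ : DecidableEq H) (_ : DistribMulAction Γ H) (N M : ℕ) (A B C : Finset H),
        TemplateTPP A B C ∧ TwistedSumFree Γ A B C ∧
        A.card = N ∧ B.card = M ∧ C.card = N ∧ 2 ≤ N ∧ (N : ℝ) ^ a ≤ M ∧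
        (Fintype.card H : ℝ) ≤ Fintype.card Γ * (N : ℝ) ^ (2 + η) := by
  intro a ha0 ha1 η hη
  obtain ⟨H, _, _, L, N, M, A, B, C, hS, hc, hN, hM, hH⟩ := hT a ha0 ha1 (η / 2) (by positivity)
  classical
  -- numerics of the witness
  have hN1 : (1 : ℝ) < N := by exact_mod_cast (by omega : 1 < N)
  have hN0 : (0 : ℝ) < N := by linarith
  have hL : 1 ≤ L := by
    rcases Nat.eq_zero_or_pos L with rfl | hLpos
    · exfalso
      have h0 : (0 : ℝ) < Fintype.card H := by exact_mod_cast Fintype.card_pos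
      rw [Nat.cast_zero, zero_mul] at hH
      linarith
    · exact hLpos
  -- the power `k` with `e ≤ (N^{η/2})^k`
  have hy : (1 : ℝ) < (N : ℝ) ^ (η / 2) := Real.one_lt_rpow hN1 (by positivity)
  obtain ⟨k, hk⟩ := pow_unbounded_of_one_lt (Real.exp 1) hy
  have hk1 : 1 ≤ k := by
    rcases Nat.eq_zero_or_pos k with rfl | hk0
    · rw [pow_zero] at hk
      exact absurd hk (not_lt.2 (Real.one_lt_exp_iff.2 one_pos).le)
    · exact hk0
  -- step 1: the `k`-th tensor power (index `Fin k → Fin L`, host `Fin k → H`)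
  set ι := Fin k → Fin L
  have hS₁ := ((isSTPP_iff_addSimultaneousTPP A B C).1 hS).pi (κ := Fin k)
  set A₁ : ι → Finset (Fin k → H) := fun I => Fintype.piFinset fun l => A (I l) with hA₁
  set B₁ : ι → Finset (Fin k → H) := fun I => Fintype.piFinset fun l => B (I l) with hB₁
  set C₁ : ι → Finset (Fin k → H) := fun I => Fintype.piFinset fun l => C (I l) with hC₁
  change AddSimultaneousTPP A₁ B₁ C₁ at hS₁
  have hcA₁ : ∀ I, (A₁ I).card = N ^ k := fun I => by
    simp only [hA₁, Fintype.card_piFinset, (hc _).1, prod_const, card_univ, Fintype.card_fin]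
  have hcB₁ : ∀ I, (B₁ I).card = M ^ k := fun I => by
    simp only [hB₁, Fintype.card_piFinset, (hc _).2.1, prod_const, card_univ, Fintype.card_fin]
  have hcC₁ : ∀ I, (C₁ I).card = N ^ k := fun I => by
    simp only [hC₁, Fintype.card_piFinset, (hc _).2.2, prod_const, card_univ, Fintype.card_fin]
  -- step 2: symmetrise over `ι`
  set n := Fintype.card ι with hn
  have hnL : n = L ^ k := by rw [hn, Fintype.card_fun, Fintype.card_fin, Fintype.card_fin]
  have hn1 : 1 ≤ n := by rw [hnL]; exact Nat.one_le_pow _ _ hL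
  letI : Fintype (Equiv.Perm ι)ᵈᵐᵃ := Fintype.ofEquiv (Equiv.Perm ι) DomMulAct.mk
  have hΓ : Fintype.card (Equiv.Perm ι)ᵈᵐᵃ = n.factorial := by
    rw [Fintype.ofEquiv_card, Fintype.card_perm]
  refine ⟨(Equiv.Perm ι)ᵈᵐᵃ, ι → (Fin k → H), inferInstance, inferInstance, inferInstance,
    inferInstance, inferInstance, inferInstance, N ^ (k * n), M ^ (k * n),
    Fintype.piFinset A₁, Fintype.piFinset B₁, Fintype.piFinset C₁,
    templateTPP_piFinset hS₁, twistedSumFree_piFinset hS₁, ?_, ?_, ?_, ?_, ?_, ?_⟩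
  · rw [card_piFinset_of_card_eq hcA₁, ← pow_mul]
  · rw [card_piFinset_of_card_eq hcB₁, ← pow_mul]
  · rw [card_piFinset_of_card_eq hcC₁, ← pow_mul]
  · calc 2 ≤ N := hN
      _ = N ^ 1 := (pow_one N).symm
      _ ≤ N ^ (k * n) := Nat.pow_le_pow_right (by omega) (Nat.one_le_iff_ne_zero.2
          (Nat.mul_ne_zero (by omega) (by omega)))
  · -- `(N^{kn})^a = (N^a)^{kn} ≤ M^{kn}`
    push_cast
    rw [← Real.rpow_natCast ((N : ℝ)), ← Real.rpow_mul hN0.le, mul_comm,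
      Real.rpow_mul_natCast hN0.le]
    exact pow_le_pow_left₀ (Real.rpow_nonneg hN0.le _) hM _
  · -- thinness: `|H|^{kn} ≤ n! (N^{kn})^{2+η}`
    rw [hΓ, Fintype.card_fun, Fintype.card_fun, Fintype.card_fin, ← hn, ← pow_mul]
    push_cast
    exact symmetrised_slack hnL (Nat.cast_nonneg _) hN0 hH hk.le

/-- **Registered stub `stub_orbitSymmetrisation`** of the line's skeleton (crux
stmt-MatrixMultiplication-10595), verbatim: the crux gives orbit designs. [new, elementary] -/
theorem stub_orbitSymmetrisation : Summit.MatrixMultiplication.MatrixMultiplication.Theses.ThinBlockAlpha.ThinPackings → (∀ a : ℝ, 0 ≤ a → a < 1 → ∀ η : ℝ, 0 < η → ∃ (Γ H : Type) (_ : Group Γ) (_ : Fintype Γ) (_ : AddCommGroup H) (_ : Fintype H) (_ : DecidableEq H) (_ : DistribMulAction Γ H) (N M : ℕ) (A B C : Finset H), TemplateTPP A B C ∧ TwistedSumFree Γ A B C ∧ A.card = N ∧ B.card = M ∧ C.card = N ∧ 2 ≤ N ∧ (N : ℝ) ^ a ≤ M ∧ (Fintype.card H : ℝ) ≤ Fintype.card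 Γ * (N : ℝ) ^ (2 + η)) :=
  fun h => orbitDesigns_of_thinPackings h

/-- **The heart of line `Ideator4Sketch` is the crux in costume**: thin near-tight orbit designs
for every shape exponent exist iff `ThinPackings` holds. [new, elementary] -/
theorem orbitDesigns_iff_thinPackings :
    (∀ a : ℝ, 0 ≤ a → a < 1 → ∀ η : ℝ, 0 < η →
      ∃ (Γ H : Type) (_ : Group Γ) (_ : Fintype Γ) (_ : AddCommGroup H) (_ : Fintype H)
        (_ : DecidableEq H) (_ : DistribMulAction Γ H) (N M : ℕ) (A B C : Finset H),
        TemplateTPP A B C ∧ TwistedSumFree Γ A B C ∧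
        A.card = N ∧ B.card = M ∧ C.card = N ∧ 2 ≤ N ∧ (N : ℝ) ^ a ≤ M ∧
        (Fintype.card H : ℝ) ≤ Fintype.card Γ * (N : ℝ) ^ (2 + η)) ↔ ThinPackings :=
  ⟨thinPackings_of_orbitDesigns, orbitDesigns_of_thinPackings⟩

end Summit.MatrixMultiplication.MatrixMultiplication.Theorems.ThinPackings.Orbit
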